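import Literature.Analysis.FluidPDE.NSWave0
import HarnessLib

/-!
# Compactly supported smooth forces are of Clay class (5)

Fefferman's force class (5) of the Clay problem statement — `|∂ₓ^α ∂ₜ^m f(x,t)| ≤ C_{αmK}(1+|x|+t)^{−K}`
on `ℝⁿ × [0,∞)` for all `α, m, K`, the tree's `Literature.Analysis.FluidPDE.HasRapidSpaceTimeDecay` — is
satisfied by every force `f` whose space–time field `uncurry f : ℝ × E → F` is `C^∞` with COMPACT
support: for each `n, K` the function `(1 + ‖x‖ + t)^K ‖Dⁿ(uncurry f)(t,x)‖` is continuous with compact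
support, hence bounded, and on the uniquely differentiable closed half-space `[0,∞) × E` the derivatives
`iteratedFDerivWithin` are the free ones (Mathlib `iteratedFDerivWithin_eq_iteratedFDeriv`). Likewise
such an `f` is smooth on the closed half-space (`IsSmoothOnHalfSpace`, Fefferman's (6)/(11) shape).

This is the standard device by which an arbitrary smooth compactly supported space–time profile becomes an
ADMISSIBLE FORCE of the forced Clay problems (C)/(D) and of forced-class claims (the force defined as the
Navier–Stokes residual of a prescribed velocity field); cf. the spatial analogue
`HasRapidSpatialDecay.of_hasCompactSupport` (`NSLerayHopfSereginEnergyProofs`).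

## References
* C. L. Fefferman, *Existence and smoothness of the Navier–Stokes equation*, Clay Mathematics Institute
  (2000/2006), eqs. (5), (6).
-/

noncomputable section

open Set Function
open scoped ContDiff

namespace Literature.Analysis.FluidPDE

variable {E : Type*} [NormedAddCommGroup E] [InnerProductSpace ℝ E]
variable {F : Type*} [NormedAddCommGroup F] [NormedSpace ℝ F]

/-- **Fefferman's (5) for compactly supported smooth forces.** If `uncurry f : ℝ × E → F` is `C^∞`
with compact support, then `f` has rapid space–time decay on the closed half-space `[0,∞) × E`: for each
`n, K` the continuous compactly supported function `(1 + ‖x‖ + t)^K ‖Dⁿ(uncurry f)(t,x)‖` is bounded,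
and `iteratedFDerivWithin` on the (uniquely differentiable) half-space agrees with `iteratedFDeriv`.
[cite: FeffermanClay2006, eq. (5)] -/
theorem HasRapidSpaceTimeDecay.of_hasCompactSupport {f : ℝ → E → F}
    (hs : ContDiff ℝ ∞ (uncurry f)) (hc : HasCompactSupport (uncurry f)) :
    HasRapidSpaceTimeDecay f := by
  intro n K
  have hU : UniqueDiffOn ℝ (Ici (0 : ℝ) ×ˢ (univ : Set E)) :=
    (uniqueDiffOn_Ici 0).prod uniqueDiffOn_univ
  set g : ℝ × E → ℝ := fun z => (1 + ‖z.2‖ + z.1) ^ K * ‖iteratedFDeriv ℝ n (uncurry f) z‖ with hg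
  have hgc : Continuous g :=
    (((continuous_const.add (continuous_norm.comp continuous_snd)).add continuous_fst).pow K).mul
      (hs.continuous_iteratedFDeriv (m := n) (mod_cast le_top)).norm
  have hgs : HasCompactSupport g := ((hc.iteratedFDeriv n).norm).mul_left
  obtain ⟨C, hC⟩ := hgc.bounded_above_of_compact_support hgs
  refine ⟨C, fun t ht x => ?_⟩
  have hmem : ((t, x) : ℝ × E) ∈ Ici (0 : ℝ) ×ˢ (univ : Set E) :=
    mk_mem_prod (mem_Ici.mpr ht) (mem_univ x)
  have hn : ContDiffAt ℝ (n : ℕ∞) (uncurry f) (t, x) := (hs.of_le (mod_cast le_top)).contDiffAt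
  rw [iteratedFDerivWithin_eq_iteratedFDeriv hU hn hmem]
  have h1 : g (t, x) ≤ C := (le_abs_self _).trans (by simpa [Real.norm_eq_abs] using hC (t, x))
  simpa [hg] using h1

/-- A force whose space–time field is `C^∞` on all of `ℝ × E` is smooth on the closed half-space
`[0,∞) × E` (Fefferman's (6)/(11) shape, the tree's `IsSmoothOnHalfSpace`). [cite: FeffermanClay2006, eq. (5)] -/
theorem IsSmoothOnHalfSpace.of_contDiff {f : ℝ → E → F} (hs : ContDiff ℝ ∞ (uncurry f)) :
    IsSmoothOnHalfSpace f :=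
  hs.contDiffOn

/-- **A compactly supported smooth space–time profile is an admissible Clay force**: smooth on the closed
half-space and rapidly decaying in space–time (Fefferman's (5) together with the smoothness clause).
[cite: FeffermanClay2006, eq. (5)] -/
theorem clayForce_of_hasCompactSupport {f : ℝ → E → F}
    (hs : ContDiff ℝ ∞ (uncurry f)) (hc : HasCompactSupport (uncurry f)) :
    IsSmoothOnHalfSpace f ∧ HasRapidSpaceTimeDecay f :=
  ⟨IsSmoothOnHalfSpace.of_contDiff hs, HasRapidSpaceTimeDecay.of_hasCompactSupport hs hc⟩

end Literature.Analysis.FluidPDE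

end
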